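import Summits.KontsevichZagierPeriods.KontsevichZagierPeriods.Theorems.IsogenyCertificatesAlgebraicModuliRealPeriodCellPeriodRep
import Summits.KontsevichZagierPeriods.KontsevichZagierPeriods.Theorems.IsogenyCertificatesAlgebraicModuliRealPeriodCellOrbitRatioAux
import Summits.KontsevichZagierPeriods.KontsevichZagierPeriods.Theorems.IsogenyCertificatesXMapKernelStubOrbitCollapse

/-!
# `AlgebraicModuliRealPeriodCell` (stmt-KontsevichZagierPeriods-18265, route IsogenyCertificates) —
line `Sketch`, stub **V**: the orbit ratio of the real periods

Port of the `ℚ`-line's orbit collapse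
(`Theorems/IsogenyCertificatesXMapKernelStubOrbitCollapse.lean`) to REAL-ALGEBRAIC moduli
`α, β, α', β'` and data `f, g, c` (coefficients in `K := ℚ̄ ∩ ℝ`).

**Statement.** Along a real-algebraic x-rational isogeny datum `(f, g, c)` between the nonsingular
cubics `y² = P := x³ + αx + β` and `y² = Q := x³ + α'x + β'` (`W := f'g − fg' ≠ 0`,
`c²·g·(f³ + α'fg² + β'g³) = P·W²`), the full real periods `Ω(α, β) = ∫_{P>0} dx/√P` and `Ω(α', β')`
have a POSITIVE REAL-ALGEBRAIC ratio.

**Proof** (the field-generic steps 1–2 are in the auxiliary file `…OrbitRatioAux.lean`). The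
datum descends to `K = algebraicClosure ℚ ℝ` (`datum_of_map`), over which:
(1) *normalisation* (`exists_datum_natDegree_lt`, any field): `deg g < deg f` after composing with
the translation by the `K`-rational `2`-torsion point `(R(∞), 0)` of the target
(`limit_value_is_root`, `three_mul_sq_add_ne_zero`); (2) *the isogeny* (`nonempty_isogenyFormula`,
any field): such a datum is a tree `WeierstrassCurve.IsogenyFormula`, hence an `Isogeny` over `K`
(Silverman *AEC* III.4.8); (3) *the archimedean factor* (`realPeriod_ratio`): the tree's
`Isogeny.exists_algebraMap_card_ker_inf_realPoints_mul_realPeriod_eq` (Milne *ADT* I.7) over the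
subfield `K ⊆ ℝ` gives `k ∈ Kˣ` with `#ker · Ω(α', β') = [coker] · |k| · Ω(α, β)`, `#ker ≥ 1`
(the `ℚ`-file's generic `finite_ker_baseChange`, `card_ker_inf_pos`), so
`q = #ker/([coker]·|k|) ∈ K_{>0}`; (4) *bridge* to the `Fin 1`-integrals: `setIntegral_rep`.

References: Silverman, *The Arithmetic of Elliptic Curves* (2009), III.4.8, Remark III.4.13.2;
Milne, *Arithmetic Duality Theorems* (2006), I.7; Kontsevich–Zagier, *Periods* (2001), §1.1.
-/

noncomputable section

namespace Summit.KontsevichZagierPeriods.IsogenyCertificates.AlgRealPeriodCell.OrbitRatio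

open Polynomial Set MeasureTheory
open Summit.KontsevichZagierPeriods.IsogenyCertificates.AlgRealPeriodCell.PeriodRep
  (exists_map_eq_of_coeff_isAlgebraic setIntegral_rep realPeriod_pos algebraicClosure_isAlgebraic)
open Summit.KontsevichZagierPeriods.IsogenyCertificates.XMapKernelStubs.OrbitCollapse
  (finite_ker_baseChange card_ker_inf_pos)

/-! ## §1 The archimedean factor over the field `ℚ̄ ∩ ℝ` of real algebraic numbers -/

/-- A real algebraic number is the image of an element of `ℚ̄ ∩ ℝ`. [folklore] -/
theorem exists_algebraMap_eq {x : ℝ} (hx : IsAlgebraic ℚ x) :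
    ∃ y : ↥(algebraicClosure ℚ ℝ), algebraMap (↥(algebraicClosure ℚ ℝ)) ℝ y = x :=
  ⟨⟨x, mem_algebraicClosure_iff.2 hx⟩, rfl⟩

/-- The base change to `ℝ` of the short model over `ℚ̄ ∩ ℝ` is the real short model. [folklore] -/
theorem curveK_baseChange (a b : ↥(algebraicClosure ℚ ℝ)) :
    (⟨0, 0, 0, a, b⟩ : WeierstrassCurve ↥(algebraicClosure ℚ ℝ)).baseChange ℝ =
      (⟨0, 0, 0, algebraMap (↥(algebraicClosure ℚ ℝ)) ℝ a,
        algebraMap (↥(algebraicClosure ℚ ℝ)) ℝ b⟩ : WeierstrassCurve ℝ) := by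
  ext <;> simp [WeierstrassCurve.baseChange, WeierstrassCurve.map]

/-- Nonsingularity descends from `ℝ` to `ℚ̄ ∩ ℝ`. [folklore] -/
theorem disc_ne_zero_of_algebraMap {a b : ↥(algebraicClosure ℚ ℝ)}
    (h : 4 * (algebraMap (↥(algebraicClosure ℚ ℝ)) ℝ a) ^ 3 +
      27 * (algebraMap (↥(algebraicClosure ℚ ℝ)) ℝ b) ^ 2 ≠ 0) :
    4 * a ^ 3 + 27 * b ^ 2 ≠ 0 := by
  intro h0
  apply h
  have := congrArg (algebraMap (↥(algebraicClosure ℚ ℝ)) ℝ) h0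
  simp only [map_add, map_mul, map_pow, map_ofNat, map_zero] at this
  exact this

/-- `4a³ + 27b² ≠ 0` makes `y² = x³ + ax + b` an elliptic curve over `ℚ̄ ∩ ℝ`
(`Δ = −16(4a³ + 27b²)`). [folklore] -/
theorem curveK_isElliptic {a b : ↥(algebraicClosure ℚ ℝ)} (h : 4 * a ^ 3 + 27 * b ^ 2 ≠ 0) :
    (⟨0, 0, 0, a, b⟩ : WeierstrassCurve ↥(algebraicClosure ℚ ℝ)).IsElliptic := by
  rw [WeierstrassCurve.isElliptic_iff, isUnit_iff_ne_zero]
  have : (⟨0, 0, 0, a, b⟩ : WeierstrassCurve ↥(algebraicClosure ℚ ℝ)).Δ =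
      -16 * (4 * a ^ 3 + 27 * b ^ 2) := by
    simp only [WeierstrassCurve.Δ, WeierstrassCurve.b₂, WeierstrassCurve.b₄, WeierstrassCurve.b₆,
      WeierstrassCurve.b₈]
    ring
  rw [this]
  exact mul_ne_zero (by norm_num) h

/-- Bookkeeping: `N·Ω₂ = M·|k|·Ω₁` with `N ≥ 1`, `k ≠ 0` real algebraic, `Ω₂ > 0` gives
`Ω₁ = q·Ω₂` with `q = N/(M|k|)` positive and real algebraic (it forces `M ≠ 0`). [folklore] -/
theorem ratio_of_count_alg {N M : ℕ} {k Ω₁ Ω₂ : ℝ} (hN : 0 < N) (hΩ₂ : 0 < Ω₂)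
    (hk : k ≠ 0) (hka : IsAlgebraic ℚ k) (h : (N : ℝ) * Ω₂ = (M : ℝ) * |k| * Ω₁) :
    ∃ q : ℝ, IsAlgebraic ℚ q ∧ 0 < q ∧ Ω₁ = q * Ω₂ := by
  have hM : 0 < M := by
    refine Nat.pos_of_ne_zero fun hM0 => ?_
    rw [hM0, Nat.cast_zero, zero_mul, zero_mul] at h
    exact (mul_pos (Nat.cast_pos.mpr hN) hΩ₂).ne' h
  have hkℝ : (0 : ℝ) < |k| := abs_pos.mpr hk
  have hMℝ : (0 : ℝ) < (M : ℝ) := Nat.cast_pos.mpr hM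
  have hNℝ : (0 : ℝ) < (N : ℝ) := Nat.cast_pos.mpr hN
  refine ⟨(N : ℝ) / ((M : ℝ) * |k|), ?_, div_pos hNℝ (mul_pos hMℝ hkℝ), ?_⟩
  · rw [← mem_algebraicClosure_iff] at hka ⊢
    refine div_mem (natCast_mem _ N) (mul_mem (natCast_mem _ M) ?_)
    rcases abs_choice k with habs | habs <;> rw [habs]
    exacts [hka, neg_mem hka]
  · field_simp
    linear_combination -h

open scoped Classical in
/-- **The archimedean factor over `ℚ̄ ∩ ℝ`** (the heart of stub V). For a datum `(f, g, c)` over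
`K = ℚ̄ ∩ ℝ` with `deg g < deg f` between real-nonsingular `(α, β)`, `(α', β')`, the real periods
of the base-changed models satisfy `Ω(α, β) = q · Ω(α', β')` with `q` positive and real algebraic:
the datum is an isogeny formula, hence an isogeny `ψ` over `K` (AEC III.4.8), and the archimedean
factor of `ψ` over the subfield `K ⊆ ℝ` (Milne *ADT* I.7: `#ker · Ω' = [coker] · |k| · Ω`,
`k ∈ Kˣ`, `#ker ≥ 1`) gives `q = #ker/([coker]·|k|)`.
[cite: MilneADT2006, Ch. I §7, proof of Thm. 7.3, p. 98] -/
theorem realPeriod_ratio {αK βK α'K β'K cK : ↥(algebraicClosure ℚ ℝ)}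
    {f₁ g₁ : (↥(algebraicClosure ℚ ℝ))[X]}
    (hΔ : 4 * (algebraMap (↥(algebraicClosure ℚ ℝ)) ℝ αK) ^ 3 +
      27 * (algebraMap (↥(algebraicClosure ℚ ℝ)) ℝ βK) ^ 2 ≠ 0)
    (hΔ' : 4 * (algebraMap (↥(algebraicClosure ℚ ℝ)) ℝ α'K) ^ 3 +
      27 * (algebraMap (↥(algebraicClosure ℚ ℝ)) ℝ β'K) ^ 2 ≠ 0)
    (hW : derivative f₁ * g₁ - f₁ * derivative g₁ ≠ 0)
    (hI : C (cK ^ 2) * g₁ * (f₁ ^ 3 + C α'K * f₁ * g₁ ^ 2 + C β'K * g₁ ^ 3) =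
      (X ^ 3 + C αK * X + C βK) * (derivative f₁ * g₁ - f₁ * derivative g₁) ^ 2)
    (hdeg : g₁.natDegree < f₁.natDegree) :
    ∃ q : ℝ, IsAlgebraic ℚ q ∧ 0 < q ∧
      (⟨0, 0, 0, algebraMap (↥(algebraicClosure ℚ ℝ)) ℝ αK,
          algebraMap (↥(algebraicClosure ℚ ℝ)) ℝ βK⟩ : WeierstrassCurve ℝ).realPeriod =
        q * (⟨0, 0, 0, algebraMap (↥(algebraicClosure ℚ ℝ)) ℝ α'K,
          algebraMap (↥(algebraicClosure ℚ ℝ)) ℝ β'K⟩ : WeierstrassCurve ℝ).realPeriod := by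
  haveI := curveK_isElliptic (disc_ne_zero_of_algebraMap hΔ)
  haveI := curveK_isElliptic (disc_ne_zero_of_algebraMap hΔ')
  haveI : Module.IsTorsionFree (↥(algebraicClosure ℚ ℝ))
      (AlgebraicClosure ↥(algebraicClosure ℚ ℝ)) := DivisionSemiring.to_moduleIsTorsionFree
  haveI : Module.IsTorsionFree (↥(algebraicClosure ℚ ℝ)) ℂ :=
    DivisionSemiring.to_moduleIsTorsionFree
  -- any `K`-embedding `K̄ → ℂ`
  letI : Algebra (AlgebraicClosure ↥(algebraicClosure ℚ ℝ)) ℂ :=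
    (IsAlgClosed.lift : AlgebraicClosure ↥(algebraicClosure ℚ ℝ) →ₐ[↥(algebraicClosure ℚ ℝ)] ℂ)
      |>.toRingHom.toAlgebra
  haveI : IsScalarTower (↥(algebraicClosure ℚ ℝ)) (AlgebraicClosure ↥(algebraicClosure ℚ ℝ)) ℂ :=
    IsScalarTower.of_algebraMap_eq fun x =>
      ((IsAlgClosed.lift :
        AlgebraicClosure ↥(algebraicClosure ℚ ℝ) →ₐ[↥(algebraicClosure ℚ ℝ)] ℂ).commutes x).symm
  obtain ⟨φ⟩ := nonempty_isogenyFormula hW hI hdeg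
  obtain ⟨k, hk0, hperiod, -⟩ :=
    φ.toIsogeny.exists_algebraMap_card_ker_inf_realPoints_mul_realPeriod_eq
  have hN := card_ker_inf_pos (φ.toIsogeny.baseChange (M := ℂ))
    (finite_ker_baseChange (M := ℂ) φ.toIsogeny)
    (WeierstrassCurve.Affine.Point.map
      (W' := (⟨0, 0, 0, αK, βK⟩ : WeierstrassCurve ↥(algebraicClosure ℚ ℝ)))
      (IsScalarTower.toAlgHom (↥(algebraicClosure ℚ ℝ)) ℝ ℂ)).range
  rw [curveK_baseChange, curveK_baseChange] at hperiod
  exact ratio_of_count_alg hN (realPeriod_pos hΔ') ((_root_.map_ne_zero _).mpr hk0)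
    (algebraicClosure_isAlgebraic k) hperiod

/-! ## §2 The stub -/

/-- **V — orbit ratio.** Along a real-algebraic x-rational isogeny datum `(f, g, c)` between the
nonsingular short Weierstrass cubics `y² = x³ + αx + β` and `y² = x³ + α'x + β'` with real
algebraic moduli, the full real periods `∫_{P>0} dx/√P` and `∫_{Q>0} dx/√Q` have a positive real
algebraic ratio: move to the coefficient field `ℚ̄ ∩ ℝ` (`datum_of_map`), normalise the datum to
`deg g < deg f` by a `2`-torsion translation (`exists_datum_natDegree_lt`), read it as an isogeny
over `ℚ̄ ∩ ℝ` (AEC III.4.8) and take the archimedean factor of that isogeny (Milne *ADT* I.7,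
`realPeriod_ratio`), then pass to the `Fin 1`-integrals by `setIntegral_rep`.
[cite: MilneADT2006, Ch. I §7, proof of Thm. 7.3, p. 98] -/
theorem stub_algOrbitRatio : ∀ (α β α' β' : ℝ), IsAlgebraic ℚ α → IsAlgebraic ℚ β → IsAlgebraic ℚ α' → IsAlgebraic ℚ β' → 4 * α ^ 3 + 27 * β ^ 2 ≠ 0 → 4 * α' ^ 3 + 27 * β' ^ 2 ≠ 0 → (∃ (f g : Polynomial ℝ) (c : ℝ), (∀ n, IsAlgebraic ℚ (f.coeff n)) ∧ (∀ n, IsAlgebraic ℚ (g.coeff n)) ∧ IsAlgebraic ℚ c ∧ Polynomial.derivative f * g - f * Polynomial.derivative g ≠ 0 ∧ Polynomial.C (c ^ 2) * g * (f ^ 3 + Polynomial.C α' * f * g ^ 2 + Polynomial.C β' * g ^ 3) = (Polynomial.X ^ 3 + Polynomial.C α * Polynomial.X + Polynomial.C β) * (Polynomial.derivative f * g - f * Polynomial.derivative g) ^ 2) → ∃ q : ℝ, IsAlgebraic ℚ q ∧ 0 < q ∧ (∫ x in {x : Fin 1 → ℝ | 0 < x 0 ^ 3 + α * x 0 + β},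 1 / Real.sqrt (x 0 ^ 3 + α * x 0 + β)) = q * (∫ x in {x : Fin 1 → ℝ | 0 < x 0 ^ 3 + α' * x 0 + β'}, 1 / Real.sqrt (x 0 ^ 3 + α' * x 0 + β')) := by
  rintro α β α' β' hα hβ hα' hβ' hΔ hΔ' ⟨f, g, c, hf, hg, hc, hW, hI⟩
  -- move the moduli, the scalar and the data to `K = ℚ̄ ∩ ℝ`
  obtain ⟨αK, rfl⟩ := exists_algebraMap_eq hα
  obtain ⟨βK, rfl⟩ := exists_algebraMap_eq hβ
  obtain ⟨α'K, rfl⟩ := exists_algebraMap_eq hα'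
  obtain ⟨β'K, rfl⟩ := exists_algebraMap_eq hβ'
  obtain ⟨cK, rfl⟩ := exists_algebraMap_eq hc
  obtain ⟨f₁, rfl⟩ := exists_map_eq_of_coeff_isAlgebraic f hf
  obtain ⟨g₁, rfl⟩ := exists_map_eq_of_coeff_isAlgebraic g hg
  obtain ⟨hWK, hIK⟩ := datum_of_map (algebraMap (↥(algebraicClosure ℚ ℝ)) ℝ) hW hI
  -- normalise, take the archimedean factor, bridge to the `Fin 1`-integrals
  obtain ⟨f₂, g₂, c₂, hW₂, hI₂, hdeg⟩ :=
    exists_datum_natDegree_lt (disc_ne_zero_of_algebraMap hΔ') hWK hIK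
  obtain ⟨q, hqa, hq, hΩ⟩ := realPeriod_ratio hΔ hΔ' hW₂ hI₂ hdeg
  refine ⟨q, hqa, hq, ?_⟩
  rw [setIntegral_rep _ _ 1, setIntegral_rep _ _ 1, one_mul, one_mul, hΩ]

end Summit.KontsevichZagierPeriods.IsogenyCertificates.AlgRealPeriodCell.OrbitRatio

end
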